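import Literature.GroupTheory.ArithmeticGroups.SL2PrimePowTopLayer
import Mathlib.GroupTheory.Commutator.Basic
import HarnessLib

/-!
# Matrix identities in `SL₂(ℤ/8)` for the base case of the `2`-adic descent

Concrete identities in `SL₂(ℤ/8)` (hypothesis form: `T̄ = (1 1; 0 1)`, `L̄ = (1 0; 1 1)` are given by their
entries) used in the proof that a central extension of `SL₂(ℤ/8)` with kernel of exponent `2` and `t^8 = 1`
has `ker ∩ [E, E] = 1` (`SL2Mod8SchurMultiplier`): with `U = L̄²`, `D = [T̄, U]`, `Y = [U, D]`:
`[T̄⁴, L̄²] = 1`; `Y = [T̄², L̄²] = T̄ L̄⁴ T̄⁻¹ L̄⁻⁴ T̄⁴ = 5·1` (a central scalar); `T̄ U T̄⁻¹ · T̄² = 3·1 · U³ T̄⁴`;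
`T̄⁴` centralises `Γ̄(2)`; the elements `Dⁱ Yʲ` (`i < 4`, `j < 2`) are distinct from `1`; and the reductions
modulo `4` needed to decompose `Γ̄(2) ⊂ SL₂(ℤ/8)`.  [CalegariDimitrovTang2025, §4.5, Lemma 4.5.10 (levels 8, 16
by machine computation)]; [Beyl1986].
-/

open scoped MatrixGroups commutatorElement
open Matrix Matrix.SpecialLinearGroup

namespace Literature.GroupTheory.ArithmeticGroups

namespace SL2Mod8

variable (T L : SL(2, ZMod (2 ^ 3)))
  (hT : (T : Matrix (Fin 2) (Fin 2) (ZMod (2 ^ 3))) = !![1, 1; 0, 1])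
  (hL : (L : Matrix (Fin 2) (Fin 2) (ZMod (2 ^ 3))) = !![1, 0; 1, 1])

include hT in
/-- `T̄⁴ = (1 4; 0 1)` in `SL₂(ℤ/8)`. [cite: CalegariDimitrovTang2025, §4.5, Lemma 4.5.10] -/
theorem coe_T_pow_four : ((T ^ 4 : SL(2, ZMod (2 ^ 3))) : Matrix (Fin 2) (Fin 2) (ZMod (2 ^ 3))) =
    !![1, 4; 0, 1] := by
  rw [SL2TopLayer.tBar_pow T hT 4]; norm_num

include hT in
/-- `T̄² = (1 2; 0 1)`. [cite: CalegariDimitrovTang2025, §4.5, Lemma 4.5.10] -/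
theorem coe_T_sq : ((T ^ 2 : SL(2, ZMod (2 ^ 3))) : Matrix (Fin 2) (Fin 2) (ZMod (2 ^ 3))) =
    !![1, 2; 0, 1] := by
  rw [SL2TopLayer.tBar_pow T hT 2]; norm_num

include hL in
/-- `L̄² = (1 0; 2 1)`. [cite: CalegariDimitrovTang2025, §4.5, Lemma 4.5.10] -/
theorem coe_L_sq : ((L ^ 2 : SL(2, ZMod (2 ^ 3))) : Matrix (Fin 2) (Fin 2) (ZMod (2 ^ 3))) =
    !![1, 0; 2, 1] := by
  rw [SL2TopLayer.lBar_pow L hL 2]; norm_num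

include hL in
/-- `L̄⁴ = (1 0; 4 1)`. [cite: CalegariDimitrovTang2025, §4.5, Lemma 4.5.10] -/
theorem coe_L_pow_four : ((L ^ 4 : SL(2, ZMod (2 ^ 3))) : Matrix (Fin 2) (Fin 2) (ZMod (2 ^ 3))) =
    !![1, 0; 4, 1] := by
  rw [SL2TopLayer.lBar_pow L hL 4]; norm_num

include hT hL in
/-- `D := [T̄, L̄²] = (7 6; 4 7)`. [cite: CalegariDimitrovTang2025, §4.5, Lemma 4.5.10] -/
theorem coe_D : ((⁅T, L ^ 2⁆ : SL(2, ZMod (2 ^ 3))) : Matrix (Fin 2) (Fin 2) (ZMod (2 ^ 3))) =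
    !![7, 6; 4, 7] := by
  rw [commutatorElement_def, coe_mul, coe_mul, coe_mul, coe_inv, coe_inv, coe_L_sq L hL, hT]
  ext i j; fin_cases i <;> fin_cases j <;> simp [Matrix.mul_apply, Fin.sum_univ_two, Matrix.adjugate_fin_two] <;>
    decide

include hT hL in
/-- `Y := [L̄², D] = 5·1`. [cite: CalegariDimitrovTang2025, §4.5, Lemma 4.5.10] -/
theorem coe_Y : ((⁅L ^ 2, ⁅T, L ^ 2⁆⁆ : SL(2, ZMod (2 ^ 3))) : Matrix (Fin 2) (Fin 2) (ZMod (2 ^ 3))) =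
    !![5, 0; 0, 5] := by
  rw [commutatorElement_def (L ^ 2), coe_mul, coe_mul, coe_mul, coe_inv, coe_inv, coe_D T L hT hL, coe_L_sq L hL]
  ext i j; fin_cases i <;> fin_cases j <;> simp [Matrix.mul_apply, Fin.sum_univ_two, Matrix.adjugate_fin_two] <;>
    decide

include hT hL in
/-- `[T̄², L̄²] = 5·1`. [cite: CalegariDimitrovTang2025, §4.5, Lemma 4.5.10] -/
theorem coe_B : ((⁅T ^ 2, L ^ 2⁆ : SL(2, ZMod (2 ^ 3))) : Matrix (Fin 2) (Fin 2) (ZMod (2 ^ 3))) =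
    !![5, 0; 0, 5] := by
  rw [commutatorElement_def, coe_mul, coe_mul, coe_mul, coe_inv, coe_inv, coe_T_sq T hT, coe_L_sq L hL]
  ext i j; fin_cases i <;> fin_cases j <;> simp [Matrix.mul_apply, Fin.sum_univ_two, Matrix.adjugate_fin_two] <;>
    decide

include hT hL in
/-- `[T̄⁴, L̄²] = 1` in `SL₂(ℤ/8)`. [cite: CalegariDimitrovTang2025, §4.5, Lemma 4.5.10] -/
theorem comm_T4_L2 : ⁅T ^ 4, L ^ 2⁆ = 1 := by
  apply Subtype.ext
  rw [commutatorElement_def, coe_mul, coe_mul, coe_mul, coe_inv, coe_inv, coe_T_pow_four T hT, coe_L_sq L hL]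
  ext i j; fin_cases i <;> fin_cases j <;> simp [Matrix.mul_apply, Fin.sum_univ_two, Matrix.adjugate_fin_two] <;>
    decide

include hT hL in
/-- `h̄ := T̄ L̄⁴ T̄⁻¹ L̄⁻⁴ T̄⁴ = 5·1` (the diagonal top-layer generator is the scalar `5` at level `8`). [cite:
CalegariDimitrovTang2025, §4.5, Lemma 4.5.10] -/
theorem coe_H : ((T * L ^ 4 * T⁻¹ * (L ^ 4)⁻¹ * T ^ 4 : SL(2, ZMod (2 ^ 3))) : Matrix (Fin 2) (Fin 2) (ZMod (2 ^ 3))) =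
    !![5, 0; 0, 5] := by
  rw [coe_mul, coe_mul, coe_mul, coe_mul, coe_inv, coe_inv, coe_T_pow_four T hT, coe_L_pow_four L hL, hT]
  ext i j; fin_cases i <;> fin_cases j <;> simp [Matrix.mul_apply, Fin.sum_univ_two, Matrix.adjugate_fin_two] <;>
    decide

/-- Scalar matrices are central in `SL₂`. [cite: CalegariDimitrovTang2025, §4.5, Lemma 4.5.10] -/
theorem scalar_comm {c : ZMod (2 ^ 3)} (S : SL(2, ZMod (2 ^ 3)))
    (hS : (S : Matrix (Fin 2) (Fin 2) (ZMod (2 ^ 3))) = !![c, 0; 0, c]) (g : SL(2, ZMod (2 ^ 3))) :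
    g * S = S * g := by
  apply Subtype.ext
  rw [coe_mul, coe_mul, hS]
  ext i j; fin_cases i <;> fin_cases j <;> simp [Matrix.mul_apply, Fin.sum_univ_two] <;> ring

include hT hL in
/-- `(T̄ L̄² T̄⁻¹) T̄² (L̄⁶ T̄⁴)⁻¹ = 3·1`. [cite: CalegariDimitrovTang2025, §4.5, Lemma 4.5.10] -/
theorem coe_conj_rel : ((T * L ^ 2 * T⁻¹ * T ^ 2 * (L ^ 6 * T ^ 4)⁻¹ : SL(2, ZMod (2 ^ 3))) :
    Matrix (Fin 2) (Fin 2) (ZMod (2 ^ 3))) = !![3, 0; 0, 3] := by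
  have hL6 : ((L ^ 6 : SL(2, ZMod (2 ^ 3))) : Matrix (Fin 2) (Fin 2) (ZMod (2 ^ 3))) = !![1, 0; 6, 1] := by
    rw [SL2TopLayer.lBar_pow L hL 6]; norm_num
  rw [coe_mul, coe_mul, coe_mul, coe_mul, coe_inv, coe_inv, coe_mul, hL6, coe_T_pow_four T hT, coe_T_sq T hT,
    coe_L_sq L hL, hT]
  ext i j; fin_cases i <;> fin_cases j <;> simp [Matrix.mul_apply, Fin.sum_univ_two, Matrix.adjugate_fin_two] <;>
    decide

include hT hL in
/-- `D⁴ = 1` for `D = [T̄, L̄²]`. [cite: CalegariDimitrovTang2025, §4.5, Lemma 4.5.10] -/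
theorem D_pow_four : (⁅T, L ^ 2⁆ : SL(2, ZMod (2 ^ 3))) ^ 4 = 1 := by
  apply Subtype.ext
  rw [coe_pow, coe_D T L hT hL]
  ext i j; fin_cases i <;> fin_cases j <;> decide

include hT hL in
/-- `Y² = 1`. [cite: CalegariDimitrovTang2025, §4.5, Lemma 4.5.10] -/
theorem Y_sq : (⁅L ^ 2, ⁅T, L ^ 2⁆⁆ : SL(2, ZMod (2 ^ 3))) ^ 2 = 1 := by
  apply Subtype.ext
  rw [coe_pow, coe_Y T L hT hL]
  ext i j; fin_cases i <;> fin_cases j <;> decide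

include hT hL in
/-- `Dⁱ Yʲ = 1` with `i < 4`, `j < 2` forces `i = j = 0`. [cite: CalegariDimitrovTang2025, §4.5, Lemma 4.5.10] -/
theorem D_pow_mul_Y_pow_eq_one {i j : ℕ} (hi : i < 4) (hj : j < 2)
    (h : (⁅T, L ^ 2⁆ : SL(2, ZMod (2 ^ 3))) ^ i * ⁅L ^ 2, ⁅T, L ^ 2⁆⁆ ^ j = 1) : i = 0 ∧ j = 0 := by
  have hc := congr_arg (fun M : SL(2, ZMod (2 ^ 3)) ↦ (M : Matrix (Fin 2) (Fin 2) (ZMod (2 ^ 3)))) h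
  simp only [coe_mul, coe_pow, coe_D T L hT hL, coe_Y T L hT hL, coe_one] at hc
  interval_cases i <;> interval_cases j <;> simp_all <;> revert hc <;> decide

include hT in
/-- `T̄⁴` centralises `Γ̄(2) ⊂ SL₂(ℤ/8)`: if `M ≡ 1 (mod 2)` then `[T̄⁴, M] = 1` (`(1+4E)(1+2X) = (1+2X)(1+4E)`
modulo `8`). [cite: CalegariDimitrovTang2025, §4.5, Lemma 4.5.10] -/
theorem comm_T4_of_layer (M : SL(2, ZMod (2 ^ 3))) {a b c d : ZMod (2 ^ 3)}
    (hM : (M : Matrix (Fin 2) (Fin 2) (ZMod (2 ^ 3))) = !![1 + 2 * a, 2 * b; 2 * c, 1 + 2 * d]) :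
    ⁅T ^ 4, M⁆ = 1 := by
  rw [commutatorElement_eq_one_iff_mul_comm]
  apply Subtype.ext
  rw [coe_mul, coe_mul, coe_T_pow_four T hT, hM]
  have h8 : (8 : ZMod (2 ^ 3)) = 0 := by decide
  ext i j; fin_cases i <;> fin_cases j <;>
    simp [Matrix.mul_apply, Fin.sum_univ_two] <;>
    first
      | linear_combination c * h8
      | linear_combination (-c) * h8
      | linear_combination (d - a) * h8

end SL2Mod8

end Literature.GroupTheory.ArithmeticGroups
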